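import Summits.CriticalPhenomena.PercolationContinuityZ3.Theorems.PercNearOneGluingNoHeavyLowerTailHullPortTASDefs
import HarnessLib

/-!
# `NoHeavyLowerTail` (stmt-CriticalPhenomena-4575) — the SET-OBSERVER `T_A` functionals (definitions)

Definitions file (prover `prim-hp-7`; `--supports stmt-CriticalPhenomena-4575`).  Kozma–Nitzan's Question 9
(arXiv:2401.12397, p. 36) at `|A| = 3` reduces (coupling seat `prim-cplus-coupling`, memo A5-COUPLING-gen13.md §5;
tree: `Q7Psi.hx_set_of_setMDL`, `Q7Psi.gpsi_three_set_of_halves`) to ONE covariance lemma, the SET-OBSERVER marker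
dominance lemma: for the owner `s`, an avoided set `X`, a marker `y` and an observer SET `N`,
`μ(y ↮ X∪{s}, y ↔ N, N ↮ X∪{s}) · cov_D(f(C_s), 1{s ↔ y}) ≤ μ(y ↮ X∪{s}) · cov_D(f(C_s), 1{s ↔ N}·1{N ↮ X})`,
`D = {s ↮ X}`.  prim-hp-7's proof (cell memos HP7-MDLX-PROOF.md; set version: A5-COUPLING-gen13.md §4, refereed in
FROM-prim-hp-7-g29-REFEREE-MDLSET.md) runs the `T_A` induction of `…HullPortTADefs`/`…HullPortTAInduction` with the
observer vertex `z` replaced by the set `N`.  This file defines the corresponding functionals in the bookkeeping of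
`…HullPortTADefs` (sum level, `BHK2006.weight`, `delE`, `cut`, `avoidEv`; `connS` of `…HullPortTASDefs`):
`sepEv N T = {N ↮ T}`, `avoidCut N` (the cut set contains no loop `s(n, n)`, `n ∈ N`: no vertex of `N` is joined
to `X`), and with `K̄ = cut X ω`: `taNWN` (`1{N ∩ V(C_X) = ∅} · μ_{G−K̄}(s ↮ y, y ↔ N, N ↮ s)` — the coefficient
`r^N_K` of the memo carries the indicator, `r^N_K := 0` when `N` meets the cluster of `X`), `taAN = Σ_ω w 1_{s↮X}
(taNWN/taN) c`, `taaN = μ(y ↮ s, X; y ↔ N; N ↮ s, X)`, `taQN = taAN·tab − taaN·taB` (`= b·T^N_A`); `taC`, `taN`,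
`taB`, `tab` are the observer-free functionals of `…HullPortTADefs`.  At `N = {z}` (`z ∉ X ∪ {s}`) these are NOT
literally `taNW`, `taa` (the extra separation `{N ↮ s, X}`), but the induction is the same.
[cite: VandenbergHaggstromKahn2005, §1 pp. 3–5 (induced model on `G − Z`) — bookkeeping]
[cite: KozmaNitzan2024, Question 9 (p. 36)]
-/

noncomputable section

namespace Summit.CriticalPhenomena.PercolationContinuityZ3.Theorems

open MeasureTheory Set Literature.Probability.LatticeModels Literature.Probability.Percolation
open scoped Classical

variable {V : Type*}

namespace HullPort

open BHK2006 DecisionTree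

section TAN

variable [Fintype V]

/-- `{N ↮ T}`: no vertex of `N` is joined by an open path to a vertex of `T`. [folklore] -/
def sepEv (N T : Set V) : Set (Set (Sym2 V)) := {ω | ∀ n ∈ N, ∀ t ∈ T, ¬ (openGraph ω).Reachable n t}

/-- The cut sets containing no loop at a vertex of `N`: for `B = cut X ω` this says that no vertex of `N` lies in
the open vertex cluster of `X` (`s(n, n) ∈ cut X ω ↔ X ↔ n`). [folklore] -/
def avoidCut (N : Set V) : Set (Set (Sym2 V)) := {B | ∀ n ∈ N, s(n, n) ∉ B}

/-- `1{N ∩ V(C_X(ω)) = ∅} · μ_{G − cut_X(ω)}(s ↮ y, y ↔ N, N ↮ s)` (the memo's `P_K(N) · r^N_K`, `K = C_X(ω)`, with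
`r^N_K := 0` when `N` meets `K`). (transcription of the cell memo prim-cplus-coupling A5-COUPLING-gen13.md §4 (4a),(4c)) [folklore] -/
def taNWN (w : Sym2 V → ℝ) (s y : V) (N X : Set V) (ω : Set (Sym2 V)) : ℝ :=
  ind (avoidCut N) (cut X ω) *
    delE w (cut X ω) (ind ((openConn s y : Set (BondConfig V))ᶜ ∩ (connS N y ∩ sepEv N {s})))

/-- `A^N = Σ_ω w(ω) 1{s ↮ X} (taNWN/taN)(ω) c(ω)`. (transcription of the cell memo prim-cplus-coupling
A5-COUPLING-gen13.md §4) [folklore] -/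
def taAN (w : Sym2 V → ℝ) (s y : V) (N X : Set V) (g : Set (Sym2 V) → ℝ) : ℝ :=
  ∑ ω, weight w ω * (ind (avoidEv s X) ω * (taNWN w s y N X ω / taN w s y X ω * taC w s y X g ω))

/-- `a^N = μ(y ↮ s, y ↮ X, y ↔ N, N ↮ s, N ↮ X)`. (transcription of the cell memo prim-cplus-coupling
A5-COUPLING-gen13.md §4 (4b)) [folklore] -/
def taaN (w : Sym2 V → ℝ) (s y : V) (N X : Set V) : ℝ :=
  ∑ ω, weight w ω * ind (avoidEv y (insert s X) ∩ (connS N y ∩ sepEv N (insert s X))) ω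

/-- `Q^N = A^N·b − a^N·B` (`= b · T^N_A` of the memo). (transcription of the cell memo prim-cplus-coupling
A5-COUPLING-gen13.md §4) [folklore] -/
def taQN (w : Sym2 V → ℝ) (s y : V) (N X : Set V) (g : Set (Sym2 V) → ℝ) : ℝ :=
  taAN w s y N X g * tab w s y X - taaN w s y N X * taB w s y X g

end TAN

end HullPort

end Summit.CriticalPhenomena.PercolationContinuityZ3.Theorems
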